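import Literature.NumberTheory.EllipticCurves.Gamma0CocycleDegeneracyHecke
import HarnessLib

/-!
# Route `ManinLocalTwoThree`, crux C2 `ManinOddAtFour` (stmt-BirchSwinnertonDyer-22967): telescoping a MULTI-shift
# annihilation `∏_{d ∈ ds} (π_d^* − π_1^*) u = 0` down to `u = 0` through SINGLE-shift relative Ihara steps
# (line prover p3; pure cocycle algebra over the T-es-12 vocabulary, MEMO-es §21.3)

For the `p = 2` generation stub E-es-22 the depleting operator is `∏_{t ∈ Gen(N)} (1 − π_t^*)` with
`Gen(N) = {8} ∪ {q ∥ N}`, while the cell's relative Ihara statement E-es-25 (typer g4's `RelativeIharaShiftVanishing p t n`)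
is a SINGLE-shift statement `π_{t^n}^* u = π_1^* u ⟹ u = 0` for generalised Hecke eigen-cocycles `u ∈ Hom(Γ₀(L), K)` with a
non-Eisenstein system. This file proves the telescoping: if every modulus `d` of a list `ds` (pairwise distinct, positive)
satisfies the single-shift vanishing at all levels `L'` divisible by a base `B`, then for `u ∈ Z¹(Γ₀(L), K)` (`B ∣ L`) a
generalised eigen-cocycle away from `S ⊇ primes(L ∏ ds)`, the vanishing on `Γ₀(L ∏ ds)` of the alternating sum
`Σ_{T ⊆ ds} (−1)^{|T|} u(diag(∏T,1) γ diag(∏T,1)⁻¹)` forces `u = 0` (`eq_zero_of_altSum_conjAt_eq_zero`). Induction on `ds`: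
`v = π_d^* u − π_1^* u ∈ Z¹(Γ₀(Ld), K)` is again a generalised eigen-cocycle (`isHeckeGenEigenvector_degeneracyPullbackZ`,
T-es-12 Hecke file), its alternating sum over the tail is the one of `u` over `d :: tail` (composition of the degeneracy
conjugations), so `v = 0` by induction, and then `u = 0` by the single-shift step at `d`. `conjAt` is the total (junk
value `1`) version of `Gamma0.degeneracyConj`, so that sums over subsets need no proofs under the binder.
Nothing about BSD, Manin's conjecture or E-es-25 is proved here.
-/

set_option autoImplicit false
set_option linter.dupNamespace false

noncomputable section

open scoped MatrixGroups BigOperators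

open CongruenceSubgroup Literature.NumberTheory.EllipticCurves.ModularForms
  Literature.NumberTheory.EllipticCurves.ModularForms.HidaCohomology

namespace Summit.BirchSwinnertonDyer.BirchSwinnertonDyer.Theorems.ManinLocalTwoThree

/-- **Total degeneracy conjugation** `Γ₀(M) → Γ₀(L)`, `γ ↦ diag(D,1) γ diag(D,1)⁻¹` when `D ≠ 0` and `L D ∣ M`
(`Gamma0.degeneracyConj L M D`), and the junk value `1` otherwise. [folklore] -/
def conjAt (L M D : ℕ) (γ : Gamma0 M) : Gamma0 L :=
  if h : D ≠ 0 ∧ L * D ∣ M then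
    haveI : NeZero D := ⟨h.1⟩
    Gamma0.degeneracyConj L M D h.2 γ
  else 1

/-- `conjAt` agrees with `Gamma0.degeneracyConj` on its domain. [folklore] -/
theorem conjAt_eq {L M D : ℕ} [NeZero D] (h : L * D ∣ M) (γ : Gamma0 M) :
    conjAt L M D γ = Gamma0.degeneracyConj L M D h γ := by
  rw [conjAt, dif_pos ⟨NeZero.ne D, h⟩]

/-- `conjAt L L 1` is the identity. [folklore] -/
theorem conjAt_self_one {L : ℕ} (γ : Gamma0 L) : conjAt L L 1 γ = γ := by
  rw [conjAt_eq (L := L) (M := L) (D := 1) (by simp) γ]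
  exact Subtype.ext (Gamma0.coe_degeneracyConj_one (M := L) (L := L) (by simp) γ)

/-- **Composition**: `conjAt L L₁ D₂ ∘ conjAt L₁ M D₁ = conjAt L M (D₂ D₁)` on the domains
(`Gamma0.degeneracyConj_degeneracyConj`). [folklore] -/
theorem conjAt_conjAt {L L₁ M D₁ D₂ : ℕ} (hD₁ : D₁ ≠ 0) (hD₂ : D₂ ≠ 0) (h₁ : L₁ * D₁ ∣ M)
    (h₂ : L * D₂ ∣ L₁) (γ : Gamma0 M) :
    conjAt L L₁ D₂ (conjAt L₁ M D₁ γ) = conjAt L M (D₂ * D₁) γ := by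
  haveI : NeZero D₁ := ⟨hD₁⟩
  haveI : NeZero D₂ := ⟨hD₂⟩
  haveI : NeZero (D₂ * D₁) := ⟨Nat.mul_ne_zero hD₂ hD₁⟩
  have h : L * (D₂ * D₁) ∣ M :=
    dvd_trans (by rw [← mul_assoc]; exact mul_dvd_mul_right h₂ D₁) h₁
  rw [conjAt_eq h₁, conjAt_eq h₂, conjAt_eq h, Gamma0.degeneracyConj_degeneracyConj h₁ h₂ h]

/-- The degree-`0` pull-back evaluated through `conjAt`: `(π_D^* u)(γ) = u(conjAt L M D γ)`. [folklore] -/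
theorem degeneracyPullback_zero_eq_conjAt {L M D : ℕ} [NeZero D] {R : Type*} [CommRing R] (h : L * D ∣ M)
    (u : Gamma0 L → Fin 1 → R) (γ : Gamma0 M) :
    degeneracyPullback 0 L M D R h u γ = u (conjAt L M D γ) := by
  rw [degeneracyPullback_zero_apply, conjAt_eq h]

/-- **Peeling one modulus off the alternating sum**: for `d ∉ s`,
`Σ_{T ⊆ insert d s} (−1)^{|T|} F(∏T) = Σ_{T ⊆ s} (−1)^{|T|} F(∏T) − Σ_{T ⊆ s} (−1)^{|T|} F(d ∏T)`. [folklore] -/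
theorem sum_powerset_insert_alternating {A : Type*} [AddCommGroup A] {s : Finset ℕ} {d : ℕ} (hd : d ∉ s)
    (F : ℕ → A) :
    ∑ T ∈ (insert d s).powerset, (-1 : ℤ) ^ T.card • F (∏ t ∈ T, t) =
      ∑ T ∈ s.powerset, (-1 : ℤ) ^ T.card • F (∏ t ∈ T, t) -
        ∑ T ∈ s.powerset, (-1 : ℤ) ^ T.card • F (d * ∏ t ∈ T, t) := by
  rw [Finset.sum_powerset_insert hd, sub_eq_add_neg, ← Finset.sum_neg_distrib]
  congr 1
  refine Finset.sum_congr rfl fun T hT => ?_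
  have hdT : d ∉ T := fun h => hd (Finset.mem_powerset.mp hT h)
  rw [Finset.card_insert_of_notMem hdT, Finset.prod_insert hdT, pow_succ, mul_neg_one, neg_smul]

/-- **Telescoping multi-shift annihilation down to zero through single-shift relative Ihara steps.** Let `K` be a field,
`S` a finite set of primes, `λ : ℕ → K`, `B` a base level, and `ds` a list of pairwise distinct positive moduli such that
for every `d ∈ ds` the single-shift vanishing holds at every level `L'` with `B ∣ L'`: a `λ`-generalised Hecke
eigen-cocycle `v ∈ Z¹(Γ₀(L'), K)` away from `S ⊇ primes(L' d)` with `π_d^* v = π_1^* v` on `Γ₀(L' d)` is zero. Then for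
`B ∣ L`, `M = L ∏ ds`, `S ⊇ primes(M)` and a `λ`-generalised eigen-cocycle `u ∈ Z¹(Γ₀(L), K)`: if
`Σ_{T ⊆ ds} (−1)^{|T|} u(conjAt L M (∏T) γ) = 0` for all `γ ∈ Γ₀(M)`, then `u = 0`. [folklore] -/
theorem eq_zero_of_altSum_conjAt_eq_zero {K : Type*} [Field K] (S : Finset ℕ) (lam : ℕ → K) (B : ℕ) :
    ∀ (ds : List ℕ), ds.Nodup → (∀ d ∈ ds, 0 < d) →
      (∀ d ∈ ds, ∀ (L' : ℕ) [NeZero L'] [NeZero d] (v : cocycles 0 L' K), B ∣ L' →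
        (∀ q : ℕ, q.Prime → q ∣ L' * d → q ∈ S) → IsHeckeGenEigenvector S lam v →
        degeneracyPullback 0 L' (L' * d) d K dvd_rfl (v : Gamma0 L' → Fin 1 → K) =
          degeneracyPullback 0 L' (L' * d) 1 K (by simp) (v : Gamma0 L' → Fin 1 → K) →
        v = 0) →
      ∀ (L M : ℕ) [NeZero L] [NeZero M], B ∣ L → M = L * ds.prod → (∀ q : ℕ, q.Prime → q ∣ M → q ∈ S) →
        ∀ u : cocycles 0 L K, IsHeckeGenEigenvector S lam u →
          (∀ (γ : Gamma0 M) (i : Fin 1),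
            ∑ T ∈ ds.toFinset.powerset,
              (-1 : ℤ) ^ T.card • (u : Gamma0 L → Fin 1 → K) (conjAt L M (∏ t ∈ T, t) γ) i = 0) →
          u = 0 := by
  intro ds
  induction ds with
  | nil =>
    intro _ _ _ L M _ _ _ hM _ u _ hsum
    have hML : M = L := by simpa using hM
    subst hML
    apply Subtype.ext
    funext γ i
    have h := hsum γ i
    simp only [List.toFinset_nil, Finset.powerset_empty, Finset.sum_singleton, Finset.card_empty, pow_zero,
      Finset.prod_empty, one_smul, conjAt_self_one] at h
    exact h
  | cons d ds ih =>
    intro hnd hpos hRI L M _ _ hB hM hS u hu hsum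
    obtain ⟨hdds, hnd'⟩ := List.nodup_cons.mp hnd
    have hd0 : 0 < d := hpos d List.mem_cons_self
    haveI : NeZero d := NeZero.of_pos hd0
    haveI : NeZero (L * d) := ⟨Nat.mul_ne_zero (NeZero.ne L) hd0.ne'⟩
    have hLdM : L * d ∣ M := ⟨ds.prod, by rw [hM, List.prod_cons, mul_assoc]⟩
    have hS₁ : ∀ q : ℕ, q.Prime → q ∣ L * d → q ∈ S := fun q hq hqd => hS q hq (hqd.trans hLdM)
    -- the one-step difference `v = π_d^* u − π_1^* u ∈ Z¹(Γ₀(Ld), K)`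
    set v : cocycles 0 (L * d) K :=
      degeneracyPullbackZ 0 L (L * d) d K dvd_rfl u - degeneracyPullbackZ 0 L (L * d) 1 K (by simp) u with hv
    have hvgen : IsHeckeGenEigenvector S lam v := by
      intro ℓ _ hℓ hℓS
      exact Submodule.sub_mem _ (isHeckeGenEigenvector_degeneracyPullbackZ dvd_rfl hS₁ hu ℓ hℓ hℓS)
        (isHeckeGenEigenvector_degeneracyPullbackZ (by simp) hS₁ hu ℓ hℓ hℓS)
    have hcoe : (v : Gamma0 (L * d) → Fin 1 → K) =
        degeneracyPullback 0 L (L * d) d K dvd_rfl (u : Gamma0 L → Fin 1 → K) -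
          degeneracyPullback 0 L (L * d) 1 K (by simp) (u : Gamma0 L → Fin 1 → K) := by
      rw [hv, Submodule.coe_sub, coe_degeneracyPullbackZ, coe_degeneracyPullbackZ]
    -- its alternating sum over the tail is the alternating sum of `u` over `d :: ds`
    have hdnot : d ∉ ds.toFinset := fun h => hdds (List.mem_toFinset.mp h)
    have hsum' : ∀ (γ : Gamma0 M) (i : Fin 1),
        ∑ T ∈ ds.toFinset.powerset,
          (-1 : ℤ) ^ T.card • (v : Gamma0 (L * d) → Fin 1 → K) (conjAt (L * d) M (∏ t ∈ T, t) γ) i = 0 := by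
      intro γ i
      have h := hsum γ i
      rw [List.toFinset_cons,
        sum_powerset_insert_alternating hdnot (fun D => (u : Gamma0 L → Fin 1 → K) (conjAt L M D γ) i),
        sub_eq_zero] at h
      have hterm : ∀ T ∈ ds.toFinset.powerset,
          (-1 : ℤ) ^ T.card • (v : Gamma0 (L * d) → Fin 1 → K) (conjAt (L * d) M (∏ t ∈ T, t) γ) i =
            (-1 : ℤ) ^ T.card • (u : Gamma0 L → Fin 1 → K) (conjAt L M (d * ∏ t ∈ T, t) γ) i -
              (-1 : ℤ) ^ T.card • (u : Gamma0 L → Fin 1 → K) (conjAt L M (∏ t ∈ T, t) γ) i := by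
        intro T hT
        have hTpos : (∏ t ∈ T, t) ≠ 0 := Finset.prod_ne_zero_iff.mpr fun t ht =>
          (hpos t (List.mem_cons_of_mem d (List.mem_toFinset.mp (Finset.mem_powerset.mp hT ht)))).ne'
        have hTdvd : L * d * ∏ t ∈ T, t ∣ M := by
          rw [hM, List.prod_cons, ← mul_assoc]
          refine mul_dvd_mul_left (L * d) ?_
          have hprod : ds.prod = ∏ t ∈ ds.toFinset, t := by
            rw [List.prod_toFinset (fun t : ℕ => t) hnd', List.map_id']
          rw [hprod]
          exact Finset.prod_dvd_prod_of_subset _ _ _ (Finset.mem_powerset.mp hT)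
        rw [← smul_sub, hcoe, Pi.sub_apply, Pi.sub_apply, degeneracyPullback_zero_eq_conjAt,
          degeneracyPullback_zero_eq_conjAt, conjAt_conjAt hTpos hd0.ne' hTdvd dvd_rfl,
          conjAt_conjAt hTpos one_ne_zero hTdvd (by simp), one_mul]
      rw [Finset.sum_congr rfl hterm, Finset.sum_sub_distrib, sub_eq_zero]
      exact h.symm
    have hv0 : v = 0 :=
      ih hnd' (fun e he => hpos e (List.mem_cons_of_mem d he)) (fun e he => hRI e (List.mem_cons_of_mem d he))
        (L * d) M (hB.mul_right d) (by rw [hM, List.prod_cons, mul_assoc]) hS v hvgen hsum'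
    -- hence `π_d^* u = π_1^* u` on `Γ₀(Ld)`, and the single-shift step at `d` gives `u = 0`
    have heq : degeneracyPullback 0 L (L * d) d K dvd_rfl (u : Gamma0 L → Fin 1 → K) =
        degeneracyPullback 0 L (L * d) 1 K (by simp) (u : Gamma0 L → Fin 1 → K) := by
      rw [← sub_eq_zero, ← hcoe, hv0, Submodule.coe_zero]
    exact hRI d List.mem_cons_self L u hB hS₁ hu heq

end Summit.BirchSwinnertonDyer.BirchSwinnertonDyer.Theorems.ManinLocalTwoThree

end
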